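import Summits.Ventures.WeilGRH.KeyPolytope
import HarnessLib

/-!
# GRH arm (rh-explicit, venture WeilGRH): the ONE-VECTOR PRINCIPLE — a key's form is affine in the prime data, with coefficients the autocorrelation spikes of the test function

Cell `rh-explicit`, WEIL TRACK — GRH ARM, sequel of `KeyPolytope.lean` (keys `(a, L, v)`, forms
`E_{a,L,v,N}(g) = (1/2π)∫|ĝ(½+iτ)|² M_{a,L,v,N}(τ) dτ`, ripple `ρ_{v,N}`, `WeilPositivityOnKey`).
Write `k = g ⋆ g̃` (`weilConv g (weilReflect g)`, the autocorrelation kernel; `k(−x) = conj k(x)`,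
`weilConv_weilReflect_neg`).  Mellin inversion on `Re s = ½` (tree lemma
`mul_weilConv_weilReflect_add_conj_mul_neg_eq_integral`) turns every twisted spike into position space:

  `(1/2π)∫|ĝ(½+iτ)|²·2(Re ω cos τx + Im ω sin τx) dτ = ω k(x) + ω̄ k(−x) = 2 Re(ω k(x))`
  (`integral_norm_sq_weilMellin_mul_spike`), hence

  **`E_{a,L,v,N}(g) = E_{a,L,0,N}(g) − Σ_{n ≤ N} (Λ(n)/√n)·2 Re(v(n) k(log n))`**
  (`weilFinitePrimeQuadraticKey_eq_zero_key_sub_spikes`):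

for a FIXED test function the key form is an AFFINE function of the prime data `v`, with coefficients
the spikes `2(Λ(n)/√n) k(log n)` of the autocorrelation of `g` at the visible prime-power logarithms
(for a character, `v = χ`; `E_{a,L,0,N}` is the centre of the polytope).  Consequences, all elementary:

* **two-sided spike bound** (`|Re(v k)| ≤ ‖v‖‖k‖`): for `‖v(n)‖ ≤ 1`,
  `|E_{a,L,v,N}(g) − E_{a,L,0,N}(g)| ≤ Σ_{n ≤ N} (Λ(n)/√n)·2‖k(log n)‖`
  (`weilFinitePrimeQuadraticKey_le_zero_key_add`, `weilFinitePrimeQuadraticKey_ge_zero_key_sub`);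
* **the one-vector maximum principle**: if the data `v⋆` is ANTI-ALIGNED with the spikes of `g`
  (`Re(v⋆(n) k(log n)) = −‖k(log n)‖` at every visible `n` with `Λ(n) ≠ 0`), then
  `E_{a,L,v,N}(g) ≤ E_{a,L,v⋆,N}(g)` for ALL data with `‖v(n)‖ ≤ 1`
  (`weilFinitePrimeQuadraticKey_le_of_antialigned`): on the vector `g` the anti-aligned key has the
  LARGEST form among all keys of the same parity and level.  Hence any margin valid for some key on the
  window is at most the Rayleigh quotient of `g` at `v⋆` (`keyMargin_le_of_antialigned` — this is the
  inequality `sup_z F_N(t; a, z) ≤ ⟨u, S(z⋆)u⟩/‖u‖²` of the arm's «even maximum principle proved by one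
  vector», with `u = g` the ground vector of the extremal key), and if the anti-aligned key FAILS on `g`
  then every key of norm `≤ 1` fails at that level and window (`not_weilPositivityOnKey_of_antialigned`);
  symmetrically the ALIGNED key has the smallest form on `g` (`weilFinitePrimeQuadraticKey_ge_of_aligned`);
* **real test functions**: if `g` is real (`conj g = g`) then `k` is real
  (`conj_weilConv_weilReflect_of_real`), the `Im v(n)` terms drop out and the law reads
  `E_{a,L,v,N}(g) = E_{a,L,0,N}(g) − Σ_{n ≤ N} a_n(g)·Re v(n)`, `a_n(g) = (Λ(n)/√n)·2k(log n)`
  (`weilFinitePrimeQuadraticKey_eq_of_real` — «a one-parity real u kills the Im-terms»), and anti-alignment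
  is the sign condition `Re v⋆(n)·k(log n) = −|k(log n)|`, i.e. `v⋆(n) = −sgn a_n(g)` wherever
  `a_n(g) ≠ 0` (`weilFinitePrimeQuadraticKey_le_of_real_sign`): a real key whose visible values are
  `−sgn a_n(u)` for its own ground vector `u` realises the supremum of the margins over ALL phase data.

Everything is PROVED; no named facts; RH/GRH-free; generic (no instance data: the certified vectors,
the sign checks `a₂ ≥ 4a₄ ≥ 0`, `a₃ ≥ 0` and the Rayleigh bounds of the arm's cells are instance files).

## References
* A. Weil, *Sur les "formules explicites" de la théorie des nombres premiers* (1952), (11) pp. 261–262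
  (the prime term `Σ Λ(n)(χ(n)F(log n) + χ̄(n)F(−log n))`, linear in the character values).
  [Weil1952FormulesExplicites]
* E. Bombieri, *Remarks on Weil's quadratic functional in the theory of prime numbers I*, Rend. Mat.
  Acc. Lincei (9) 11 (2000), §2 (Mellin inversion on vertical lines; the hermitian kernel `f * f̄*`).
  [Bombieri2000Weil]
* H. Yoshida, *On Hermitian forms attached to zeta functions*, Adv. Stud. Pure Math. 21 (1992), §2 (2.1)
  (shape of the window forms). [Yoshida1992]
* Cell record: rh-explicit HOME `GRH/STRUCTURE.md` §16(f) addendum 5 (weil-grh-4 gen6, sha16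
  9444f058530d8833): «the even maximum principle below (log 5)/2 is proved by one vector» — the
  instance whose generic half is typed here.
-/

noncomputable section

open Complex Set MeasureTheory
open scoped Real ArithmeticFunction.vonMangoldt ComplexConjugate

namespace Summit.Ventures.WeilGRH

open Literature.NumberTheory.LFunctions

variable {g : ℝ → ℂ}

/-! ## One twisted spike in position space -/

/-- **One twisted spike = `2 Re(ω k(x))`**:
`(1/2π)∫|ĝ(½+iτ)|²·2(Re ω cos(τx) + Im ω sin(τx)) dτ = 2 Re(ω·(g ⋆ g̃)(x))`
(Mellin inversion at `± x` and `k(−x) = conj k(x)`).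
[cite: Bombieri2000Weil, §2 (inverse Mellin transform on Re s = 1/2, hermitian kernel); Weil1952FormulesExplicites, (11) pp. 261–262] -/
theorem integral_norm_sq_weilMellin_mul_spike (hg : IsWeilTest g) (ω : ℂ) (x : ℝ) :
    1 / (2 * π) * ∫ τ : ℝ, ‖weilMellin g (1 / 2 + τ * I)‖ ^ 2 *
        (2 * (ω.re * Real.cos (τ * x) + ω.im * Real.sin (τ * x))) =
      2 * (ω * weilConv g (weilReflect g) x).re := by
  have h := mul_weilConv_weilReflect_add_conj_mul_neg_eq_integral hg ω x
  rw [weilConv_weilReflect_neg, ← map_mul, Complex.add_conj] at h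
  have e : (1 / (2 * π) : ℂ) = ((1 / (2 * π) : ℝ) : ℂ) := by push_cast; ring
  rw [e, ← Complex.ofReal_mul] at h
  exact_mod_cast h.symm

/-- The ripple form in position space:
`(1/2π)∫|ĝ(½+iτ)|² ρ_{v,N}(τ) dτ = Σ_{n ≤ N} (Λ(n)/√n)·2 Re(v(n) k(log n))`, `k = g ⋆ g̃`.
[cite: Weil1952FormulesExplicites, (11) pp. 261–262 (prime term at F = g ⋆ g̃); Bombieri2000Weil, §2] -/
theorem integral_norm_sq_weilMellin_mul_weilPrimeRippleKey_eq (hg : IsWeilTest g) (v : ℕ → ℂ) (N : ℕ) :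
    1 / (2 * π) * ∫ τ : ℝ, ‖weilMellin g (1 / 2 + τ * I)‖ ^ 2 * weilPrimeRippleKey v N τ =
      ∑ n ∈ Finset.range (N + 1), (Λ n : ℝ) / Real.sqrt n *
        (2 * (v n * weilConv g (weilReflect g) (Real.log n)).re) := by
  have e : (fun τ : ℝ ↦ ‖weilMellin g (1 / 2 + τ * I)‖ ^ 2 * weilPrimeRippleKey v N τ) =
      fun τ : ℝ ↦ ∑ n ∈ Finset.range (N + 1), (Λ n : ℝ) / Real.sqrt n *
        (‖weilMellin g (1 / 2 + τ * I)‖ ^ 2 *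
          (2 * ((v n).re * Real.cos (τ * Real.log n) + (v n).im * Real.sin (τ * Real.log n)))) := by
    funext τ
    unfold weilPrimeRippleKey
    rw [Finset.mul_sum]
    exact Finset.sum_congr rfl fun n _ ↦ by ring
  have hI : ∀ n ∈ Finset.range (N + 1), Integrable fun τ : ℝ ↦ (Λ n : ℝ) / Real.sqrt n *
      (‖weilMellin g (1 / 2 + τ * I)‖ ^ 2 *
        (2 * ((v n).re * Real.cos (τ * Real.log n) + (v n).im * Real.sin (τ * Real.log n)))) := by
    intro n _
    refine Integrable.const_mul ?_ _
    refine integrable_norm_sq_weilMellin_mul hg (by fun_prop)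
      (A := 2 * (|(v n).re| + |(v n).im|)) (B := 0) (by positivity) le_rfl fun τ ↦ ?_
    rw [zero_mul, add_zero, abs_mul, abs_of_pos (by norm_num : (0 : ℝ) < 2)]
    refine mul_le_mul_of_nonneg_left ((abs_add_le _ _).trans (add_le_add ?_ ?_)) (by norm_num)
    · rw [abs_mul]
      exact (mul_le_mul_of_nonneg_left (Real.abs_cos_le_one _) (abs_nonneg _)).trans (by simp)
    · rw [abs_mul]
      exact (mul_le_mul_of_nonneg_left (Real.abs_sin_le_one _) (abs_nonneg _)).trans (by simp)
  rw [e, integral_finsetSum _ hI, Finset.mul_sum]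
  refine Finset.sum_congr rfl fun n _ ↦ ?_
  rw [integral_const_mul, ← integral_norm_sq_weilMellin_mul_spike hg (v n) (Real.log n)]
  ring

/-! ## The affine law: a key's form = the centre's form minus the spikes -/

/-- **THE AFFINE LAW.**  For every test function `g`, parity `a`, level `L`, prime data `v` and `N`:
`E_{a,L,v,N}(g) = E_{a,L,0,N}(g) − Σ_{n ≤ N} (Λ(n)/√n)·2 Re(v(n)·(g ⋆ g̃)(log n))` — the form of a key
is an affine function of the data, with coefficients the autocorrelation spikes of `g`.
[cite: Weil1952FormulesExplicites, (11) pp. 261–262 (prime term linear in χ); Yoshida1992, §2 eq. (2.1) (shape)] -/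
theorem weilFinitePrimeQuadraticKey_eq_zero_key_sub_spikes (hg : IsWeilTest g) (a : ℕ) (L : ℝ)
    (v : ℕ → ℂ) (N : ℕ) :
    weilFinitePrimeQuadraticKey a L v N g =
      weilFinitePrimeQuadraticKey a L 0 N g -
        ∑ n ∈ Finset.range (N + 1), (Λ n : ℝ) / Real.sqrt n *
          (2 * (v n * weilConv g (weilReflect g) (Real.log n)).re) := by
  unfold weilFinitePrimeQuadraticKey
  have h0 := integrable_norm_sq_weilMellin_mul_weilFinitePrimeWeightKey hg a L 0 N
  have hr := integrable_norm_sq_weilMellin_mul_weilPrimeRippleKey hg v N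
  have hz : ∀ τ : ℝ, weilPrimeRippleKey 0 N τ = 0 := fun τ ↦ by
    unfold weilPrimeRippleKey
    simp
  have e : (fun τ : ℝ ↦ ‖weilMellin g (1 / 2 + τ * I)‖ ^ 2 * weilFinitePrimeWeightKey a L v N τ) =
      fun τ : ℝ ↦ ‖weilMellin g (1 / 2 + τ * I)‖ ^ 2 * weilFinitePrimeWeightKey a L 0 N τ -
        ‖weilMellin g (1 / 2 + τ * I)‖ ^ 2 * weilPrimeRippleKey v N τ := by
    funext τ
    unfold weilFinitePrimeWeightKey
    rw [hz]
    ring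
  rw [e, integral_sub h0 hr, mul_sub, integral_norm_sq_weilMellin_mul_weilPrimeRippleKey_eq hg v N]

/-! ## Spike bounds and the one-vector maximum principle -/

/-- `−‖v‖‖k‖ ≤ Re(v k) ≤ ‖v‖‖k‖`. [folklore] -/
private theorem re_mul_mem_Icc_norm (v k : ℂ) : (v * k).re ∈ Icc (-(‖v‖ * ‖k‖)) (‖v‖ * ‖k‖) := by
  have h := Complex.abs_re_le_norm (v * k)
  rw [norm_mul] at h
  exact ⟨(abs_le.1 h).1, (abs_le.1 h).2⟩

/-- The spike weights are non-negative: `0 ≤ Λ(n)/√n`. [folklore] -/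
private theorem weight_nonneg (n : ℕ) : 0 ≤ (Λ n : ℝ) / Real.sqrt n :=
  div_nonneg ArithmeticFunction.vonMangoldt_nonneg (Real.sqrt_nonneg _)

/-- **Upper spike bound**: for `‖v(n)‖ ≤ 1`,
`E_{a,L,v,N}(g) ≤ E_{a,L,0,N}(g) + Σ_{n ≤ N} (Λ(n)/√n)·2‖(g ⋆ g̃)(log n)‖`. [folklore] -/
theorem weilFinitePrimeQuadraticKey_le_zero_key_add (hg : IsWeilTest g) (a : ℕ) (L : ℝ) {v : ℕ → ℂ}
    (hv : ∀ n, ‖v n‖ ≤ 1) (N : ℕ) :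
    weilFinitePrimeQuadraticKey a L v N g ≤
      weilFinitePrimeQuadraticKey a L 0 N g +
        ∑ n ∈ Finset.range (N + 1), (Λ n : ℝ) / Real.sqrt n *
          (2 * ‖weilConv g (weilReflect g) (Real.log n)‖) := by
  rw [weilFinitePrimeQuadraticKey_eq_zero_key_sub_spikes hg a L v N]
  have hS : -(∑ n ∈ Finset.range (N + 1), (Λ n : ℝ) / Real.sqrt n *
      (2 * ‖weilConv g (weilReflect g) (Real.log n)‖)) ≤
      ∑ n ∈ Finset.range (N + 1), (Λ n : ℝ) / Real.sqrt n *
        (2 * (v n * weilConv g (weilReflect g) (Real.log n)).re) := by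
    rw [← Finset.sum_neg_distrib]
    refine Finset.sum_le_sum fun n _ ↦ ?_
    rw [← mul_neg]
    refine mul_le_mul_of_nonneg_left ?_ (weight_nonneg n)
    have h := (re_mul_mem_Icc_norm (v n) (weilConv g (weilReflect g) (Real.log n))).1
    have h1 := mul_le_of_le_one_left (norm_nonneg (weilConv g (weilReflect g) (Real.log n))) (hv n)
    linarith
  linarith

/-- **Lower spike bound**: for `‖v(n)‖ ≤ 1`,
`E_{a,L,0,N}(g) − Σ_{n ≤ N} (Λ(n)/√n)·2‖(g ⋆ g̃)(log n)‖ ≤ E_{a,L,v,N}(g)`. [folklore] -/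
theorem weilFinitePrimeQuadraticKey_ge_zero_key_sub (hg : IsWeilTest g) (a : ℕ) (L : ℝ) {v : ℕ → ℂ}
    (hv : ∀ n, ‖v n‖ ≤ 1) (N : ℕ) :
    weilFinitePrimeQuadraticKey a L 0 N g -
        ∑ n ∈ Finset.range (N + 1), (Λ n : ℝ) / Real.sqrt n *
          (2 * ‖weilConv g (weilReflect g) (Real.log n)‖) ≤
      weilFinitePrimeQuadraticKey a L v N g := by
  rw [weilFinitePrimeQuadraticKey_eq_zero_key_sub_spikes hg a L v N]
  refine sub_le_sub_left (Finset.sum_le_sum fun n _ ↦ ?_) _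
  refine mul_le_mul_of_nonneg_left ?_ (weight_nonneg n)
  have h := (re_mul_mem_Icc_norm (v n) (weilConv g (weilReflect g) (Real.log n))).2
  have h1 := mul_le_of_le_one_left (norm_nonneg (weilConv g (weilReflect g) (Real.log n))) (hv n)
  linarith

/-- **THE ONE-VECTOR MAXIMUM PRINCIPLE.**  If the data `v⋆` is anti-aligned with the spikes of `g`
— `Re(v⋆(n)·(g ⋆ g̃)(log n)) = −‖(g ⋆ g̃)(log n)‖` at every `n ≤ N` with `Λ(n) ≠ 0` — then on `g` the
key `(a, L, v⋆)` has the LARGEST form among all data of norm `≤ 1`: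
`E_{a,L,v,N}(g) ≤ E_{a,L,v⋆,N}(g)`. [folklore] -/
theorem weilFinitePrimeQuadraticKey_le_of_antialigned (hg : IsWeilTest g) (a : ℕ) (L : ℝ) (N : ℕ)
    {v vstar : ℕ → ℂ} (hv : ∀ n, ‖v n‖ ≤ 1)
    (hstar : ∀ n ∈ Finset.range (N + 1), Λ n ≠ 0 →
      (vstar n * weilConv g (weilReflect g) (Real.log n)).re = -‖weilConv g (weilReflect g) (Real.log n)‖) :
    weilFinitePrimeQuadraticKey a L v N g ≤ weilFinitePrimeQuadraticKey a L vstar N g := by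
  rw [weilFinitePrimeQuadraticKey_eq_zero_key_sub_spikes hg a L v N,
    weilFinitePrimeQuadraticKey_eq_zero_key_sub_spikes hg a L vstar N]
  refine sub_le_sub_left (Finset.sum_le_sum fun n hn ↦ ?_) _
  by_cases hΛ : Λ n = 0
  · rw [hΛ, zero_div, zero_mul, zero_mul]
  · refine mul_le_mul_of_nonneg_left ?_ (weight_nonneg n)
    rw [hstar n hn hΛ]
    have h := (re_mul_mem_Icc_norm (v n) (weilConv g (weilReflect g) (Real.log n))).1
    have h1 := mul_le_of_le_one_left (norm_nonneg (weilConv g (weilReflect g) (Real.log n))) (hv n)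
    linarith

/-- Mirror statement: if `v₊` is ALIGNED with the spikes of `g` (`Re(v₊(n) k(log n)) = +‖k(log n)‖` at
the visible `n`), the key `(a, L, v₊)` has the SMALLEST form on `g` among all data of norm `≤ 1`. [folklore] -/
theorem weilFinitePrimeQuadraticKey_ge_of_aligned (hg : IsWeilTest g) (a : ℕ) (L : ℝ) (N : ℕ)
    {v vplus : ℕ → ℂ} (hv : ∀ n, ‖v n‖ ≤ 1)
    (hplus : ∀ n ∈ Finset.range (N + 1), Λ n ≠ 0 →
      (vplus n * weilConv g (weilReflect g) (Real.log n)).re = ‖weilConv g (weilReflect g) (Real.log n)‖) :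
    weilFinitePrimeQuadraticKey a L vplus N g ≤ weilFinitePrimeQuadraticKey a L v N g := by
  rw [weilFinitePrimeQuadraticKey_eq_zero_key_sub_spikes hg a L v N,
    weilFinitePrimeQuadraticKey_eq_zero_key_sub_spikes hg a L vplus N]
  refine sub_le_sub_left (Finset.sum_le_sum fun n hn ↦ ?_) _
  by_cases hΛ : Λ n = 0
  · rw [hΛ, zero_div, zero_mul, zero_mul]
  · refine mul_le_mul_of_nonneg_left ?_ (weight_nonneg n)
    rw [hplus n hn hΛ]
    have h := (re_mul_mem_Icc_norm (v n) (weilConv g (weilReflect g) (Real.log n))).2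
    have h1 := mul_le_of_le_one_left (norm_nonneg (weilConv g (weilReflect g) (Real.log n))) (hv n)
    linarith

/-- **Margins are bounded by one vector.**  If `c` is a margin of SOME key `(a, L, v)` of norm `≤ 1` on the
window `[−log(N+1)/2, log(N+1)/2]` (`c‖h‖₂² ≤ E_{a,L,v,N}(h)` for every test `h` there) and `g` lives on that
window with `v⋆` anti-aligned to its spikes, then `c‖g‖₂² ≤ E_{a,L,v⋆,N}(g)`: the supremum over the data of
the margins is at most the Rayleigh quotient of `g` at the anti-aligned key (the cell's inequality
`sup_z F_N(t; a, z) ≤ ⟨u, S(z⋆)u⟩/‖u‖²`). [folklore] -/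
theorem keyMargin_le_of_antialigned (hg : IsWeilTest g) (a : ℕ) (L : ℝ) (N : ℕ)
    (hsupp : tsupport g ⊆ Icc (-(Real.log ((N : ℝ) + 1) / 2)) (Real.log ((N : ℝ) + 1) / 2))
    {v vstar : ℕ → ℂ} (hv : ∀ n, ‖v n‖ ≤ 1)
    (hstar : ∀ n ∈ Finset.range (N + 1), Λ n ≠ 0 →
      (vstar n * weilConv g (weilReflect g) (Real.log n)).re = -‖weilConv g (weilReflect g) (Real.log n)‖)
    {c : ℝ} (hc : ∀ h : ℝ → ℂ, IsWeilTest h →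
      tsupport h ⊆ Icc (-(Real.log ((N : ℝ) + 1) / 2)) (Real.log ((N : ℝ) + 1) / 2) →
      c * weilNorm2Sq h ≤ weilFinitePrimeQuadraticKey a L v N h) :
    c * weilNorm2Sq g ≤ weilFinitePrimeQuadraticKey a L vstar N g :=
  (hc g hg hsupp).trans (weilFinitePrimeQuadraticKey_le_of_antialigned hg a L N hv hstar)

/-- **Failure transfers from the anti-aligned key to every key.**  If `g` lives on the window and the
anti-aligned key fails on it (`E_{a,L,v⋆,N}(g) < 0`), then NO data of norm `≤ 1` gives a key that is
Weil-positive on that window at level `L`. [folklore] -/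
theorem not_weilPositivityOnKey_of_antialigned (hg : IsWeilTest g) (a : ℕ) (L : ℝ) (N : ℕ)
    (hsupp : tsupport g ⊆ Icc (-(Real.log ((N : ℝ) + 1) / 2)) (Real.log ((N : ℝ) + 1) / 2))
    {vstar : ℕ → ℂ}
    (hstar : ∀ n ∈ Finset.range (N + 1), Λ n ≠ 0 →
      (vstar n * weilConv g (weilReflect g) (Real.log n)).re = -‖weilConv g (weilReflect g) (Real.log n)‖)
    (hneg : weilFinitePrimeQuadraticKey a L vstar N g < 0) {v : ℕ → ℂ} (hv : ∀ n, ‖v n‖ ≤ 1) :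
    ¬ WeilPositivityOnKey a L v N := by
  intro hpos
  have h1 := hpos g hg hsupp
  have h2 := weilFinitePrimeQuadraticKey_le_of_antialigned hg a L N hv hstar
  linarith

/-! ## Real test functions: the `Im v(n)` terms drop out -/

/-- For a real test function (`conj g = g`) the autocorrelation `k = g ⋆ g̃` is real: `conj k(x) = k(x)`.
[cite: Bombieri2000Weil, §2 (the kernel f * f̄*)] -/
theorem conj_weilConv_weilReflect_of_real (hreal : ∀ t, conj (g t) = g t) (x : ℝ) :
    conj (weilConv g (weilReflect g) x) = weilConv g (weilReflect g) x := by
  rw [weilConv_apply, ← integral_conj]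
  congr 1 with u
  simp only [weilReflect, map_mul, hreal]

/-- `Im k(x) = 0` for real `g`. [folklore] -/
theorem weilConv_weilReflect_im_of_real (hreal : ∀ t, conj (g t) = g t) (x : ℝ) :
    (weilConv g (weilReflect g) x).im = 0 :=
  Complex.conj_eq_iff_im.1 (conj_weilConv_weilReflect_of_real hreal x)

/-- `Re(ω k(x)) = Re ω · k(x)` for real `g`. [folklore] -/
theorem re_mul_weilConv_weilReflect_of_real (hreal : ∀ t, conj (g t) = g t) (ω : ℂ) (x : ℝ) :
    (ω * weilConv g (weilReflect g) x).re = ω.re * (weilConv g (weilReflect g) x).re := by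
  rw [Complex.mul_re, weilConv_weilReflect_im_of_real hreal x, mul_zero, sub_zero]

/-- `‖k(x)‖ = |Re k(x)|` for real `g`. [folklore] -/
theorem norm_weilConv_weilReflect_of_real (hreal : ∀ t, conj (g t) = g t) (x : ℝ) :
    ‖weilConv g (weilReflect g) x‖ = |(weilConv g (weilReflect g) x).re| := by
  have e : weilConv g (weilReflect g) x = (((weilConv g (weilReflect g) x).re : ℝ) : ℂ) :=
    Complex.ext (by simp) (by simp [weilConv_weilReflect_im_of_real hreal x])
  rw [e, Complex.norm_real, Real.norm_eq_abs, Complex.ofReal_re]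

/-- **The affine law for a real test function**: `E_{a,L,v,N}(g) = E_{a,L,0,N}(g) − Σ_{n ≤ N} a_n(g)·Re v(n)`,
`a_n(g) = (Λ(n)/√n)·2(g ⋆ g̃)(log n)` («a one-parity real `u` kills the Im-terms»).
[cite: Weil1952FormulesExplicites, (11) pp. 261–262] -/
theorem weilFinitePrimeQuadraticKey_eq_of_real (hg : IsWeilTest g) (hreal : ∀ t, conj (g t) = g t)
    (a : ℕ) (L : ℝ) (v : ℕ → ℂ) (N : ℕ) :
    weilFinitePrimeQuadraticKey a L v N g =
      weilFinitePrimeQuadraticKey a L 0 N g -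
        ∑ n ∈ Finset.range (N + 1),
          (Λ n : ℝ) / Real.sqrt n * (2 * (weilConv g (weilReflect g) (Real.log n)).re) * (v n).re := by
  rw [weilFinitePrimeQuadraticKey_eq_zero_key_sub_spikes hg a L v N]
  congr 1
  refine Finset.sum_congr rfl fun n _ ↦ ?_
  rw [re_mul_weilConv_weilReflect_of_real hreal]
  ring

/-- **The maximum principle for a real test function = a sign condition.**  If `g` is real and the data
`v⋆` satisfies `Re v⋆(n)·(g ⋆ g̃)(log n) = −|(g ⋆ g̃)(log n)|` at every visible `n` with `Λ(n) ≠ 0`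
(`v⋆(n) = −sgn a_n(g)` wherever `a_n(g) ≠ 0`), then `E_{a,L,v,N}(g) ≤ E_{a,L,v⋆,N}(g)` for all data of
norm `≤ 1`. [folklore] -/
theorem weilFinitePrimeQuadraticKey_le_of_real_sign (hg : IsWeilTest g) (hreal : ∀ t, conj (g t) = g t)
    (a : ℕ) (L : ℝ) (N : ℕ) {v vstar : ℕ → ℂ} (hv : ∀ n, ‖v n‖ ≤ 1)
    (hstar : ∀ n ∈ Finset.range (N + 1), Λ n ≠ 0 →
      (vstar n).re * (weilConv g (weilReflect g) (Real.log n)).re =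
        -|(weilConv g (weilReflect g) (Real.log n)).re|) :
    weilFinitePrimeQuadraticKey a L v N g ≤ weilFinitePrimeQuadraticKey a L vstar N g :=
  weilFinitePrimeQuadraticKey_le_of_antialigned hg a L N hv fun n hn hΛ ↦ by
    rw [re_mul_weilConv_weilReflect_of_real hreal, norm_weilConv_weilReflect_of_real hreal]
    exact hstar n hn hΛ

end Summit.Ventures.WeilGRH
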